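import Literature.NumberTheory.LFunctions.Zhang2022.RepairAdmissibleWide

/-!
# Zhang (2022) §18-margin repair rung, barrier extension (slice S-E-p5-1), companion shapes of the
# verdict on the WIDE / CALCULUS classes (`ν₂ ≤ ½` and `k₁ = k₃` removed)

Trunk T-ANT (NumberTheory/LFunctions). Y. Zhang, *Discrete mean estimates and the Landau–Siegel
zero*, arXiv:2211.02515v1 (2022) [Zhang2022LandauSiegel] — **an unrefereed manuscript under
adjudication. WHAT THIS IS NOT: a claim about its Theorems 1–2, about Landau–Siegel zeros, about
Parity, or about a repaired `Margin232`. The programme SEARCHES and TYPES; no claim about Landau–Siegel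
zeros, Theorems 1–2 of arXiv:2211.02515 or a repaired Margin232 until a kernel theorem says so.**

`RepairAdmissibleWide` proves the verdict `¬ (C232S θ · C233T θ < ‖dSumS θ‖²)` on the calculus class
`AdmissibleThetaCalc` (`0 < ν₃ ≤ ν₂ < ν₁ ≤ 1`, `k_j ≠ 0`) and on the named extension class
`AdmissibleThetaWide` (`R` minus `ν₂ ≤ ½` minus `k₁ = k₃`), with the five dictionary hypotheses re-proved
(`glued_isH1_on_calc`, `tent_isH1_on_calc`, `h232_on_calc`, `h233_on_calc`, `hsum_on_calc`). This file
carries the COMPANION SHAPES of `RepairVerdictAssembly` over to both classes, in the same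
continued-calculus currency (validity off `R`: registry item E-017, open; no certificate consumed):

* `normSq_dSumS_le_calc/_wide` — Cauchy–Schwarz `|𝔡+𝔡′|² ≤ C₂₃₂·C₂₃₃`;
* `not_sqrt_closing_calc/_wide` — the `MainOrderContradiction` shape `¬ (√(C₂₃₂C₂₃₃) < |𝔡+𝔡′|)`;
* `not_printed_chain_calc/_wide` — (2.32) `C₂₃₂ < 0.001`, (2.33) `C₂₃₃ < 3000` and Prop. 2.4
  `|𝔡+𝔡′|² > 25` are jointly infeasible;
* `margin_nonneg_calc/_wide` — T-zero impossible, `0 ≤ C₂₃₂`; `trueNeed_ratio_le_one_calc/_wide`;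
* `not_repairable_true_need_frakc_calc/_wide` — the verdict with `C₂₃₂` displayed through the feeders
  `Re 𝔠₁T + Re 𝔠₂T + 2Re 𝔠₃ˢ` ((8.23), (9.7) per factor, the exact bilinear `𝔠₃` slot);
* positivity witnesses `frakc1T_re_nonneg_calc`, `frakc2T_re_nonneg_calc`, `C233T_nonneg_calc` (all from
  `𝔅 ⪰ 0`, `MainTermFormH1.mainTermForm_nonneg_of_isH1`).

## References

* Y. Zhang, arXiv:2211.02515v1 (2022), §2 Props. 2.4–2.6, (2.32)–(2.33); §8 (8.23); §9 (9.7);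
  §10 (10.19); §18 (18.1). [cite: Zhang2022LandauSiegel, §§2, 8–10, 18]
-/

noncomputable section

open Real Complex ComplexConjugate

namespace Literature.NumberTheory.LFunctions.Zhang2022

namespace Repair

variable {θ : Theta}

/-! ### Positivity witnesses on the calculus class (all from `𝔅 ⪰ 0`; no certificate) -/

/-- `Re 𝔠₁T(θ) ≥ 0` on `R_calc`. [cite: Zhang2022LandauSiegel, §8 (8.23) p.50] -/
theorem frakc1T_re_nonneg_calc (h : AdmissibleThetaCalc θ) : 0 ≤ (frakc1T θ).re := by
  rw [frakc1T_eq_mainTermForm_calc h, Complex.ofReal_re]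
  exact mainTermForm_nonneg_of_isH1 (kinkedProfile_h1Profile_calc h).isH1

/-- `Re 𝔠₂T(θ) ≥ 0` on `R_calc`. [cite: Zhang2022LandauSiegel, §9 (9.7) p.52] -/
theorem frakc2T_re_nonneg_calc (h : AdmissibleThetaCalc θ) : 0 ≤ (frakc2T θ).re := by
  rw [frakc2T_eq_mainTermForm_calc h, Complex.ofReal_re]
  exact mainTermForm_nonneg_of_isH1 (kinkedProfile_h2Profile_calc h).isH1

/-- `C₂₃₃(θ) ≥ 0` on `R_calc`. [cite: Zhang2022LandauSiegel, §10 (10.19), (2.33)] -/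
theorem C233T_nonneg_calc (h : AdmissibleThetaCalc θ) : 0 ≤ C233T θ := by
  rw [h233_on_calc θ h]
  exact mainTermForm_nonneg_of_isH1 (tent_isH1_on_calc θ h)

/-! ### Companion shapes on the calculus class -/

/-- Cauchy–Schwarz on `R_calc`: `|𝔡+𝔡′|²(θ) ≤ C₂₃₂(θ)·C₂₃₃(θ)`. [cite: Zhang2022LandauSiegel, §2 after (2.33)] -/
theorem normSq_dSumS_le_calc : ∀ θ, AdmissibleThetaCalc θ → ‖dSumS θ‖ ^ 2 ≤ C232S θ * C233T θ :=
  normSq_dSum_le_of_domination glued_isH1_on_calc tent_isH1_on_calc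
    (fun θ h => (h232_on_calc θ h).symm.le) (fun θ h => (h233_on_calc θ h).symm.le)
    (fun θ h => (hsum_on_calc θ h).symm ▸ le_rfl)

/-- The `MainOrderContradiction` shape on `R_calc`: `¬ (√(C₂₃₂C₂₃₃) < |𝔡+𝔡′|)`.
[cite: Zhang2022LandauSiegel, §2 after (2.33)] -/
theorem not_sqrt_closing_calc :
    ∀ θ, AdmissibleThetaCalc θ → ¬ (Real.sqrt (C232S θ * C233T θ) < ‖dSumS θ‖) :=
  not_sqrt_closing_of_domination glued_isH1_on_calc tent_isH1_on_calc
    (fun θ h => (h232_on_calc θ h).symm.le) (fun θ h => (h233_on_calc θ h).symm.le)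
    (fun θ h => (hsum_on_calc θ h).symm ▸ le_rfl)

/-- Printed-triple infeasibility on `R_calc`: no design has `C₂₃₂ < 0.001 ∧ C₂₃₃ < 3000 ∧ |𝔡+𝔡′|² > 25`.
[cite: Zhang2022LandauSiegel, §2 Props. 2.4–2.5, (2.32)–(2.33)] -/
theorem not_printed_chain_calc : ∀ θ, AdmissibleThetaCalc θ →
    ¬ (C232S θ < 1 / 1000 ∧ C233T θ < 3000 ∧ 25 < ‖dSumS θ‖ ^ 2) := by
  intro θ h
  rw [h232_on_calc θ h, h233_on_calc θ h, hsum_on_calc θ h]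
  exact not_printedTriple_of_isH1 (glued_isH1_on_calc θ h) (tent_isH1_on_calc θ h)

/-- T-zero is impossible on `R_calc`: `0 ≤ C₂₃₂(θ)`. [cite: Zhang2022LandauSiegel, §2 Lemma 2.3, (2.32)] -/
theorem margin_nonneg_calc : ∀ θ, AdmissibleThetaCalc θ → 0 ≤ C232S θ :=
  C232S_nonneg_of_domination glued_isH1_on_calc (fun θ h => (h232_on_calc θ h).symm.le)

/-- The variational form on `R_calc`: `|𝔡+𝔡′|² / (C₂₃₂C₂₃₃) ≤ 1`. [cite: Zhang2022LandauSiegel, §2 after (2.33)] -/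
theorem trueNeed_ratio_le_one_calc :
    ∀ θ, AdmissibleThetaCalc θ → ‖dSumS θ‖ ^ 2 / (C232S θ * C233T θ) ≤ 1 := by
  intro θ h
  rw [h232_on_calc θ h, h233_on_calc θ h, hsum_on_calc θ h]
  exact trueNeed_ratio_le_one (glued_isH1_on_calc θ h) (tent_isH1_on_calc θ h)

/-- The verdict on `R_calc` with `C₂₃₂` displayed through the three feeders:
`¬ ((Re 𝔠₁T + Re 𝔠₂T + 2Re 𝔠₃ˢ)·C₂₃₃ < |𝔡+𝔡′|²)`. [cite: Zhang2022LandauSiegel, (8.23), (9.7), (18.1), (2.32)–(2.33)] -/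
theorem not_repairable_true_need_frakc_calc : ∀ θ, AdmissibleThetaCalc θ →
    ¬ (((frakc1T θ).re + (frakc2T θ).re + 2 * (frakc3S θ).re) * C233T θ < ‖dSumS θ‖ ^ 2) := by
  intro θ h
  rw [← C232S_eq_frakc_calc h]
  exact not_repairable_true_need_calc θ h

/-! ### Companion shapes on the named extension class `R_wide` («ν₂ > ½, untied k₃») -/

/-- Cauchy–Schwarz on `R_wide`: `|𝔡+𝔡′|²(θ) ≤ C₂₃₂(θ)·C₂₃₃(θ)`. [cite: Zhang2022LandauSiegel, §2 after (2.33)] -/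
theorem normSq_dSumS_le_wide : ∀ θ, AdmissibleThetaWide θ → ‖dSumS θ‖ ^ 2 ≤ C232S θ * C233T θ :=
  fun θ h => normSq_dSumS_le_calc θ h.toCalc

/-- The `MainOrderContradiction` shape on `R_wide`: `¬ (√(C₂₃₂C₂₃₃) < |𝔡+𝔡′|)`.
[cite: Zhang2022LandauSiegel, §2 after (2.33)] -/
theorem not_sqrt_closing_wide :
    ∀ θ, AdmissibleThetaWide θ → ¬ (Real.sqrt (C232S θ * C233T θ) < ‖dSumS θ‖) :=
  fun θ h => not_sqrt_closing_calc θ h.toCalc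

/-- Printed-triple infeasibility on `R_wide`: no design has `C₂₃₂ < 0.001 ∧ C₂₃₃ < 3000 ∧ |𝔡+𝔡′|² > 25`
((2.32), (2.33), Prop. 2.4 are jointly impossible: `0.001·3000 = 3 < 25`).
[cite: Zhang2022LandauSiegel, §2 Props. 2.4–2.5, (2.32)–(2.33)] -/
theorem not_printed_chain_wide : ∀ θ, AdmissibleThetaWide θ →
    ¬ (C232S θ < 1 / 1000 ∧ C233T θ < 3000 ∧ 25 < ‖dSumS θ‖ ^ 2) :=
  fun θ h => not_printed_chain_calc θ h.toCalc

/-- T-zero is impossible on `R_wide`: `0 ≤ C₂₃₂(θ)`. [cite: Zhang2022LandauSiegel, §2 Lemma 2.3, (2.32)] -/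
theorem margin_nonneg_wide : ∀ θ, AdmissibleThetaWide θ → 0 ≤ C232S θ :=
  fun θ h => margin_nonneg_calc θ h.toCalc

/-- The variational form on `R_wide`: `|𝔡+𝔡′|² / (C₂₃₂C₂₃₃) ≤ 1`. [cite: Zhang2022LandauSiegel, §2 after (2.33)] -/
theorem trueNeed_ratio_le_one_wide :
    ∀ θ, AdmissibleThetaWide θ → ‖dSumS θ‖ ^ 2 / (C232S θ * C233T θ) ≤ 1 :=
  fun θ h => trueNeed_ratio_le_one_calc θ h.toCalc

/-- The verdict on `R_wide` with `C₂₃₂` displayed through the feeders `Re 𝔠₁T + Re 𝔠₂T + 2Re 𝔠₃ˢ`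
((8.23), (9.7) per factor — untied `k₃` enters `𝔠₂T` through `(ν₃, k₃)` only — and the exact bilinear
`𝔠₃` slot). [cite: Zhang2022LandauSiegel, (8.23), (9.7), (18.1), (2.32)–(2.33)] -/
theorem not_repairable_true_need_frakc_wide : ∀ θ, AdmissibleThetaWide θ →
    ¬ (((frakc1T θ).re + (frakc2T θ).re + 2 * (frakc3S θ).re) * C233T θ < ‖dSumS θ‖ ^ 2) :=
  fun θ h => not_repairable_true_need_frakc_calc θ h.toCalc

/-- On `R_wide` all three constants are non-negative and the cross term is dominated — the four numbers
any design in the class must produce: `0 ≤ Re 𝔠₁T`, `0 ≤ Re 𝔠₂T`, `0 ≤ C₂₃₃`, `|𝔡+𝔡′|² ≤ C₂₃₂C₂₃₃`.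
[cite: Zhang2022LandauSiegel, §8 (8.23); §9 (9.7); §10 (10.19); §2 after (2.33)] -/
theorem positivity_package_wide (h : AdmissibleThetaWide θ) :
    0 ≤ (frakc1T θ).re ∧ 0 ≤ (frakc2T θ).re ∧ 0 ≤ C233T θ ∧ ‖dSumS θ‖ ^ 2 ≤ C232S θ * C233T θ :=
  ⟨frakc1T_re_nonneg_calc h.toCalc, frakc2T_re_nonneg_calc h.toCalc, C233T_nonneg_calc h.toCalc,
    normSq_dSumS_le_wide θ h⟩

end Repair

end Literature.NumberTheory.LFunctions.Zhang2022
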